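import Literature.Topology.FourManifolds.GaussDiagramsChart
import Literature.Topology.FourManifolds.CurveFamilyIsotopy
import Mathlib.Analysis.Calculus.MeanValue
import HarnessLib

/-!
# Small perturbations of a knot in the stereographic chart are isotopic to it

Topic `Literature/Topology/FourManifolds`; third brick of the proof of the named fact
`Literature.Topology.FourManifolds.Knot.exists_hasGaussDiagram_of_isIsotopic` (`GaussDiagrams.lean`;
Reidemeister, *Knotentheorie* (1932), Kap. I §1; Cromwell, *Knots and Links* (2004), Thm. 3.2.1).
Everything here is proved; no named facts. Main statement:

* `Literature.Topology.FourManifolds.Knot.exists_isIsotopic_stereoCurve_add` — let `K` be a knot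
  missing the north pole, with chart curve `c = K.stereoCurve` (`GaussDiagramsChart.lean`). There
  is `ε > 0` such that for every `C^∞`, `2π`-periodic `P : ℝ → (ℝ × ℝ) × ℝ` with `‖P‖ ≤ ε` and
  `‖P'‖ ≤ ε` pointwise, some knot `K'` ambient isotopic to `K` misses the north pole and has chart
  curve `c + P` (so `planeCurve K' = planeCurve K + P₁`, `heightCurve K' = heightCurve K + P₂`).

**Proof.** (1) *Stability* (`exists_stability`, for curves in any real normed space): a `C¹`
regular closed curve `c` which is injective modulo its period has a local injectivity modulus
`m |s - t| ≤ ‖c s - c t‖` for `|s - t| ≤ δ` (mean value inequality against the velocity, which is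
bounded below and uniformly continuous on a period, `exists_local_modulus`) and a separation
`β ≤ ‖c s - c t‖` for parameters `δ`-far modulo the period (compactness, `exists_far_separation`);
hence `c + Q` is again regular and injective modulo the period whenever `‖Q‖ ≤ ε`, `‖Q'‖ ≤ ε`,
`ε = min (m/2) (β/3)` (Crowell–Fox, Ch. I §2: differentiable knots are stable under `C¹`-small
changes; Hirsch (1976), Ch. 2 §1, Lemma 1.3). (2) *The isotopy*: for such `P` the straight-line
family of chart curves `e_u = c + u P`, `u ∈ [0, 1]`, consists of regular curves injective modulo
`2π`, so through the inverse stereographic map it is a smooth family of regular simple closed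
curves on `𝕊³` (`pertCurveFamily`); by the tree's `IsRegularClosedCurve.isIsotopic_of_family_Icc`
(`CurveFamilyIsotopy.lean`: such a family is a smooth isotopy of knots, covered by an ambient
isotopy through the isotopy extension theorem `isAmbientIsotopic_of_isSmoothlyIsotopic_euclidean`
of `IsotopyExtension.lean`; Hirsch (1976), Ch. 8 §1, Thm. 1.3) the knots of `e_0 = c` (which is
`K`, `SphereEmbedding.toKnot_curve`) and of `e_1 = c + P` (`pertKnot`, a `knotOfStereoCurve`) are
ambient isotopic.

## References

* M. W. Hirsch, *Differential Topology*, GTM 33 (1976), Ch. 2 §1 (Lemma 1.3, `C¹`-open-ness of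
  embeddings), Ch. 8 §1, Thm. 1.3 (isotopy extension). [HirschDT1976]
* (reduction modulo the period: `exists_int_sub_mul_two_pi_mem_Ico` is the floor form of
  Mathlib's `sub_toIcoDiv_zsmul_mem_Ico`, kept as a named wrapper for the sibling files.)
* R. H. Crowell, R. H. Fox, *Introduction to Knot Theory* (1963/1977), Ch. I §2. [CrowellFox1977]
* P. R. Cromwell, *Knots and Links* (2004), Thm. 3.2.1. [Cromwell2004]

## Design notes

The stability lemmas are stated for `2π`-periodic curves in a general real normed space with
injectivity modulo the period written `c s = c t → ∃ k : ℤ, s = t + k (2π)`; the knot statements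
translate through `exists_eq_add_of_circlePoint_eq` / `periodic_circlePoint`. No statement of
another file is modified; no `sorry`; `𝔼 n`, `𝕊 n` are local notation as in `Knots.lean`.
-/

open scoped Manifold ContDiff Topology
open Function Set Metric

noncomputable section

namespace Literature.Topology.FourManifolds

/-- Local notation: `𝔼 n` is the model Euclidean space `EuclideanSpace ℝ (Fin n)`. -/
local notation "𝔼 " n:arg => EuclideanSpace ℝ (Fin n)

/-- Local notation: `𝕊 n` is the unit sphere in `EuclideanSpace ℝ (Fin (n + 1))`. -/
local notation "𝕊 " n:arg => (Metric.sphere (0 : EuclideanSpace ℝ (Fin (n + 1))) 1)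

attribute [local instance] fact_finrank_euclideanSpace_two fact_finrank_euclideanSpace_four

/-! ### Reduction modulo the period -/

/-- Every real is a translate by an integer multiple of `2π` of a real in `[0, 2π)`. [folklore] -/
theorem exists_int_sub_mul_two_pi_mem_Ico (θ : ℝ) :
    ∃ k : ℤ, θ - k * (2 * Real.pi) ∈ Ico 0 (2 * Real.pi) := by
  have h2 : (0 : ℝ) < 2 * Real.pi := by positivity
  refine ⟨⌊θ / (2 * Real.pi)⌋, ?_, ?_⟩
  · have := Int.floor_le (θ / (2 * Real.pi))
    rw [le_div_iff₀ h2] at this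
    linarith
  · have := Int.lt_floor_add_one (θ / (2 * Real.pi))
    rw [div_lt_iff₀ h2] at this
    linarith

/-! ### Stability of regular closed curves under `C¹`-small perturbations -/

section Stability

variable {F : Type*} [NormedAddCommGroup F] [NormedSpace ℝ F] {c : ℝ → F}

/-- The velocity of a periodic curve is periodic. [folklore] -/
theorem periodic_deriv_of_periodic (hper : Periodic c (2 * Real.pi)) :
    Periodic (deriv c) (2 * Real.pi) := fun θ ↦ by
  rw [← deriv_comp_add_const]
  congr 1
  funext t
  exact hper t

/-- **A positive lower bound for the speed** of a `C¹` regular closed curve. [folklore] -/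
theorem exists_pos_le_norm_deriv (hc : ContDiff ℝ 1 c) (hper : Periodic c (2 * Real.pi))
    (hreg : ∀ θ, deriv c θ ≠ 0) : ∃ m₀ > 0, ∀ θ, m₀ ≤ ‖deriv c θ‖ := by
  have hcont : Continuous (deriv c) := hc.continuous_deriv le_rfl
  obtain ⟨θ₀, -, hmin⟩ := (isCompact_Icc (a := (0 : ℝ)) (b := 2 * Real.pi)).exists_isMinOn
    (nonempty_Icc.2 (by positivity)) hcont.norm.continuousOn
  refine ⟨‖deriv c θ₀‖, norm_pos_iff.2 (hreg θ₀), fun θ ↦ ?_⟩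
  obtain ⟨k, hk⟩ := exists_int_sub_mul_two_pi_mem_Ico θ
  have hper' : deriv c (θ - k * (2 * Real.pi)) = deriv c θ := by
    have := ((periodic_deriv_of_periodic hper).int_mul (-k)) θ
    rw [← this]; congr 1; push_cast; ring
  have := hmin (Ico_subset_Icc_self hk)
  simp only [mem_setOf_eq] at this
  rwa [hper'] at this

/-- **Local injectivity modulus of a regular closed curve.** For a `C¹`, `2π`-periodic curve with
nowhere vanishing velocity there are `m > 0` and `δ > 0` with `m ≤ ‖c'‖` everywhere and
`m |s - t| ≤ ‖c s - c t‖` whenever `|s - t| ≤ δ` (mean value inequality for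
`u ↦ c u - u • c' t`, the velocity being uniformly continuous on a period). Hirsch (1976), Ch. 2
§1, Lemma 1.3. [folklore] -/
theorem exists_local_modulus (hc : ContDiff ℝ 1 c) (hper : Periodic c (2 * Real.pi))
    (hreg : ∀ θ, deriv c θ ≠ 0) :
    ∃ m > 0, ∃ δ > 0, (∀ θ, m ≤ ‖deriv c θ‖) ∧
      ∀ s t, |s - t| ≤ δ → m * |s - t| ≤ ‖c s - c t‖ := by
  obtain ⟨m₀, hm₀, hm₀le⟩ := exists_pos_le_norm_deriv hc hper hreg
  have hcont : Continuous (deriv c) := hc.continuous_deriv le_rfl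
  have hdiff : Differentiable ℝ c := hc.differentiable_one
  -- uniform continuity of the velocity on a slightly enlarged period
  set I : Set ℝ := Icc (-1) (2 * Real.pi + 1) with hI
  have huc := (isCompact_Icc (a := (-1 : ℝ)) (b := 2 * Real.pi + 1)).uniformContinuousOn_of_continuous
    hcont.continuousOn
  rw [Metric.uniformContinuousOn_iff] at huc
  obtain ⟨δ₀, hδ₀, hδ₀uc⟩ := huc (m₀ / 2) (half_pos hm₀)
  set δ : ℝ := min (δ₀ / 2) 1 with hδ
  have hδpos : 0 < δ := lt_min (half_pos hδ₀) one_pos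
  have hδ1 : δ ≤ 1 := min_le_right _ _
  have hδδ₀ : δ < δ₀ := (min_le_left _ _).trans_lt (half_lt_self hδ₀)
  refine ⟨m₀ / 2, half_pos hm₀, δ, hδpos, fun θ ↦ by linarith [hm₀le θ], fun s t hst ↦ ?_⟩
  -- translate so that `t` lies in `[0, 2π)`
  obtain ⟨k, hk⟩ := exists_int_sub_mul_two_pi_mem_Ico t
  set t' := t - k * (2 * Real.pi) with ht'
  set s' := s - k * (2 * Real.pi) with hs'
  have hcs : c s' = c s := by
    have := (hper.int_mul (-k)) s; rw [← this]; congr 1; push_cast; ring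
  have hct : c t' = c t := by
    have := (hper.int_mul (-k)) t; rw [← this]; congr 1; push_cast; ring
  have hdt : deriv c t' = deriv c t := by
    have := ((periodic_deriv_of_periodic hper).int_mul (-k)) t
    rw [← this]; congr 1; push_cast; ring
  have hst' : s' - t' = s - t := by rw [hs', ht']; ring
  have ht'I : t' ∈ I := ⟨by linarith [hk.1], by linarith [hk.2]⟩
  -- the segment between `t'` and `s'` lies in `I` and within `δ₀` of `t'`
  have hseg : ∀ u ∈ uIcc t' s', u ∈ I ∧ dist u t' < δ₀ := by
    intro u hu
    have hu' : |u - t'| ≤ |s' - t'| := abs_sub_left_of_mem_uIcc hu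
    rw [hst'] at hu'
    have h1 : |u - t'| ≤ δ := hu'.trans hst
    refine ⟨⟨?_, ?_⟩, ?_⟩
    · have := (abs_le.1 h1).1; linarith [hk.1]
    · have := (abs_le.1 h1).2; linarith [hk.2]
    · rw [Real.dist_eq]; exact h1.trans_lt hδδ₀
  -- mean value inequality for `g u = c u - u • c' t'`
  set g : ℝ → F := fun u ↦ c u - u • deriv c t' with hg
  have hgd : ∀ u, HasDerivAt g (deriv c u - deriv c t') u := fun u ↦ by
    have h1 : HasDerivAt (fun x : ℝ ↦ x • deriv c t') ((1 : ℝ) • deriv c t') u :=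
      (hasDerivAt_id u).smul_const (deriv c t')
    rw [one_smul] at h1
    exact ((hdiff u).hasDerivAt).sub h1
  have hbound : ∀ u ∈ uIcc t' s', ‖deriv g u‖ ≤ m₀ / 2 := fun u hu ↦ by
    rw [(hgd u).deriv]
    obtain ⟨huI, hut⟩ := hseg u hu
    have := hδ₀uc u huI t' ht'I hut
    rw [dist_eq_norm] at this
    exact this.le
  have hmv := (convex_uIcc t' s').norm_image_sub_le_of_norm_deriv_le
    (fun u _ ↦ (hgd u).differentiableAt) hbound left_mem_uIcc right_mem_uIcc
  -- `g s' - g t' = (c s' - c t') - (s' - t') • c' t'`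
  have hgst : g s' - g t' = (c s' - c t') - (s' - t') • deriv c t' := by
    simp only [hg, sub_smul]; abel
  rw [hgst, Real.norm_eq_abs] at hmv
  have hlow : |s' - t'| * m₀ ≤ ‖(s' - t') • deriv c t'‖ := by
    rw [norm_smul, Real.norm_eq_abs]
    exact mul_le_mul_of_nonneg_left (hm₀le t') (abs_nonneg _)
  have hup : ‖(s' - t') • deriv c t'‖ ≤ ‖c s' - c t'‖ + m₀ / 2 * |s' - t'| := by
    have e : (s' - t') • deriv c t' =
        (c s' - c t') - ((c s' - c t') - (s' - t') • deriv c t') := by abel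
    calc ‖(s' - t') • deriv c t'‖
        = ‖(c s' - c t') - ((c s' - c t') - (s' - t') • deriv c t')‖ := by rw [← e]
      _ ≤ ‖c s' - c t'‖ + ‖(c s' - c t') - (s' - t') • deriv c t'‖ := norm_sub_le _ _
      _ ≤ ‖c s' - c t'‖ + m₀ / 2 * |s' - t'| := by linarith [hmv]
  rw [← hcs, ← hct, ← hst']
  linarith [hlow, hup]

omit [NormedSpace ℝ F] in
/-- **Separation of far parameters.** For a continuous `2π`-periodic curve which is injective
modulo the period and every `δ > 0` there is `β > 0` with `β ≤ ‖c s - c t‖` whenever `s - t` is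
at distance `≥ δ` from every integer multiple of `2π` (compactness of a period square).
[folklore] -/
theorem exists_far_separation (hcont : Continuous c) (hper : Periodic c (2 * Real.pi))
    (hinj : ∀ s t, c s = c t → ∃ k : ℤ, s = t + k * (2 * Real.pi)) {δ : ℝ} (hδ : 0 < δ) :
    ∃ β > 0, ∀ s t, (∀ k : ℤ, δ ≤ |s - t - k * (2 * Real.pi)|) → β ≤ ‖c s - c t‖ := by
  set S : Set (ℝ × ℝ) := (Icc (0 : ℝ) (2 * Real.pi) ×ˢ Icc (0 : ℝ) (2 * Real.pi)) ∩
    ⋂ k : ℤ, {p : ℝ × ℝ | δ ≤ |p.1 - p.2 - k * (2 * Real.pi)|} with hS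
  have hSc : IsCompact S := by
    refine (isCompact_Icc.prod isCompact_Icc).of_isClosed_subset ?_ (fun p hp ↦ hp.1)
    refine (isClosed_Icc.prod isClosed_Icc).inter ?_
    exact isClosed_iInter fun k ↦ isClosed_le continuous_const (by fun_prop)
  set f : ℝ × ℝ → ℝ := fun p ↦ ‖c p.1 - c p.2‖ with hf
  have hfc : Continuous f :=
    ((hcont.comp continuous_fst).sub (hcont.comp continuous_snd)).norm
  have hfpos : ∀ p ∈ S, 0 < f p := by
    rintro ⟨s, t⟩ ⟨-, hfarp⟩
    refine norm_pos_iff.2 (sub_ne_zero.2 fun h ↦ ?_)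
    obtain ⟨k, hk⟩ := hinj s t h
    have := mem_iInter.1 hfarp k
    simp only [mem_setOf_eq, hk, add_sub_cancel_left, sub_self, abs_zero] at this
    linarith
  -- reduction of an arbitrary far pair into the period square
  have hred : ∀ s t, (∀ k : ℤ, δ ≤ |s - t - k * (2 * Real.pi)|) →
      ∃ p ∈ S, f p = ‖c s - c t‖ := by
    intro s t hfar'
    obtain ⟨a, ha⟩ := exists_int_sub_mul_two_pi_mem_Ico s
    obtain ⟨b, hb⟩ := exists_int_sub_mul_two_pi_mem_Ico t
    refine ⟨(s - a * (2 * Real.pi), t - b * (2 * Real.pi)),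
      ⟨⟨Ico_subset_Icc_self ha, Ico_subset_Icc_self hb⟩, mem_iInter.2 fun k ↦ ?_⟩, ?_⟩
    · have := hfar' (k + a - b)
      push_cast at this
      simp only [mem_setOf_eq]
      convert this using 2
      ring
    · have hcs : c (s - a * (2 * Real.pi)) = c s := by
        have := (hper.int_mul (-a)) s; rw [← this]; congr 1; push_cast; ring
      have hct : c (t - b * (2 * Real.pi)) = c t := by
        have := (hper.int_mul (-b)) t; rw [← this]; congr 1; push_cast; ring
      simp only [hf, hcs, hct]
  rcases S.eq_empty_or_nonempty with hSe | hSne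
  · refine ⟨1, one_pos, fun s t hfar' ↦ ?_⟩
    obtain ⟨p, hp, -⟩ := hred s t hfar'
    rw [hSe] at hp
    exact absurd hp (notMem_empty p)
  · obtain ⟨p₀, hp₀, hmin⟩ := hSc.exists_isMinOn hSne hfc.continuousOn
    refine ⟨f p₀, hfpos p₀ hp₀, fun s t hfar' ↦ ?_⟩
    obtain ⟨p, hp, hfp⟩ := hred s t hfar'
    rw [← hfp]
    exact hmin hp

/-- **Stability of regular simple closed curves under `C¹`-small perturbations.** For a `C¹`,
`2π`-periodic, regular curve `c` which is injective modulo `2π` there is `ε > 0` such that for every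
differentiable `2π`-periodic `Q` with `‖Q‖ ≤ ε` and `‖Q'‖ ≤ ε` pointwise, `c + Q` is again regular
and injective modulo `2π`. Hirsch (1976), Ch. 2 §1, Lemma 1.3; Crowell–Fox, Ch. I §2.
[cite: HirschDT1976, Ch. 2 §1, Lemma 1.3] -/
theorem exists_stability (hc : ContDiff ℝ 1 c) (hper : Periodic c (2 * Real.pi))
    (hreg : ∀ θ, deriv c θ ≠ 0) (hinj : ∀ s t, c s = c t → ∃ k : ℤ, s = t + k * (2 * Real.pi)) :
    ∃ ε > 0, ∀ Q : ℝ → F, Differentiable ℝ Q → Periodic Q (2 * Real.pi) →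
      (∀ θ, ‖Q θ‖ ≤ ε) → (∀ θ, ‖deriv Q θ‖ ≤ ε) →
      (∀ θ, deriv (fun u ↦ c u + Q u) θ ≠ 0) ∧
        ∀ s t, c s + Q s = c t + Q t → ∃ k : ℤ, s = t + k * (2 * Real.pi) := by
  obtain ⟨m, hm, δ, hδ, hmle, hmod⟩ := exists_local_modulus hc hper hreg
  obtain ⟨β, hβ, hfar⟩ := exists_far_separation hc.continuous hper hinj hδ
  have hεm : min (m / 2) (β / 3) ≤ m / 2 := min_le_left _ _
  have hεβ : min (m / 2) (β / 3) ≤ β / 3 := min_le_right _ _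
  refine ⟨min (m / 2) (β / 3), lt_min (half_pos hm) (by positivity),
    fun Q hQd hQper hQ0 hQ1 ↦ ⟨fun θ h0 ↦ ?_, fun s t hst ↦ ?_⟩⟩
  · -- regularity
    have hd : deriv (fun u ↦ c u + Q u) θ = deriv c θ + deriv Q θ :=
      deriv_add (hc.differentiable_one θ) (hQd θ)
    rw [hd] at h0
    have h1 : ‖deriv c θ‖ = ‖deriv Q θ‖ := by
      rw [eq_neg_of_add_eq_zero_left h0, norm_neg]
    linarith [hmle θ, hQ1 θ]
  · -- injectivity modulo the period
    have hdiffc : Differentiable ℝ c := hc.differentiable_one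
    have hcQ : ∀ s t, c s + Q s = c t + Q t → ‖c s - c t‖ = ‖Q s - Q t‖ := by
      intro s t h
      have e : c s - c t = -(Q s - Q t) := by
        rw [← sub_eq_zero] at h ⊢
        rw [← h]; abel
      rw [e, norm_neg]
    by_cases hnear : ∃ k : ℤ, |s - t - k * (2 * Real.pi)| < δ
    · obtain ⟨k, hk⟩ := hnear
      set t₁ := t + k * (2 * Real.pi) with ht₁
      have hct : c t₁ = c t := (hper.int_mul k) t
      have hQt : Q t₁ = Q t := (hQper.int_mul k) t
      have heq : c s + Q s = c t₁ + Q t₁ := by rw [hct, hQt]; exact hst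
      have hst₁ : |s - t₁| < δ := by
        rw [ht₁]; convert hk using 2; ring
      have h1 : m * |s - t₁| ≤ ‖c s - c t₁‖ := hmod s t₁ hst₁.le
      have h2 : ‖Q s - Q t₁‖ ≤ min (m / 2) (β / 3) * |s - t₁| := by
        have := (convex_uIcc t₁ s).norm_image_sub_le_of_norm_deriv_le
          (fun u _ ↦ (hQd u)) (fun u _ ↦ hQ1 u) left_mem_uIcc right_mem_uIcc
        rwa [Real.norm_eq_abs] at this
      rw [hcQ s t₁ heq] at h1
      have h5 : |s - t₁| = 0 := by
        by_contra hne
        have hpos : 0 < |s - t₁| := lt_of_le_of_ne (abs_nonneg _) (Ne.symm hne)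
        nlinarith
      refine ⟨k, ?_⟩
      have := abs_eq_zero.1 h5
      rw [ht₁] at this
      linarith
    · push Not at hnear
      exfalso
      have h1 : β ≤ ‖c s - c t‖ := hfar s t hnear
      rw [hcQ s t hst] at h1
      have h4 : ‖Q s - Q t‖ ≤ ‖Q s‖ + ‖Q t‖ := norm_sub_le _ _
      linarith [hQ0 s, hQ0 t]

end Stability


/-! ### The straight-line family of chart curves and its knots -/

namespace Knot

variable {K : Knot} {P : ℝ → (ℝ × ℝ) × ℝ}

/-- The **straight-line family** of chart curves `e u θ = stereoCurve K θ + u • P θ`. [folklore] -/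
def pertFamily (K : Knot) (P : ℝ → (ℝ × ℝ) × ℝ) (u θ : ℝ) : (ℝ × ℝ) × ℝ :=
  K.stereoCurve θ + u • P θ

/-- At `u = 0` the family is the chart curve of `K`. [folklore] -/
theorem pertFamily_zero : pertFamily K P 0 = K.stereoCurve := by
  funext θ; simp [pertFamily]

/-- At `u = 1` the family is `stereoCurve K + P`. [folklore] -/
theorem pertFamily_one : pertFamily K P 1 = fun θ ↦ K.stereoCurve θ + P θ := by
  funext θ; simp [pertFamily]

/-- Each stage of the family is `C^∞`. [folklore] -/
theorem contDiff_pertFamily (hK : ∀ x, K x ≠ northPole) (hP : ContDiff ℝ ∞ P) (u : ℝ) :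
    ContDiff ℝ ∞ (pertFamily K P u) :=
  (contDiff_stereoCurve hK).add (hP.const_smul u)

/-- Each stage of the family is `2π`-periodic. [folklore] -/
theorem periodic_pertFamily (hPper : Periodic P (2 * Real.pi)) (u : ℝ) :
    Periodic (pertFamily K P u) (2 * Real.pi) := fun θ ↦ by
  simp only [pertFamily, K.periodic_stereoCurve θ, hPper θ]

/-- The family is jointly `C^∞` in `(u, θ)`. [folklore] -/
theorem contDiff_uncurry_pertFamily (hK : ∀ x, K x ≠ northPole) (hP : ContDiff ℝ ∞ P) :
    ContDiff ℝ ∞ (uncurry (pertFamily K P)) := by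
  show ContDiff ℝ ∞ fun q : ℝ × ℝ ↦ K.stereoCurve q.2 + q.1 • P q.2
  exact ((contDiff_stereoCurve hK).comp contDiff_snd).add (contDiff_fst.smul (hP.comp contDiff_snd))

/-- The size of the perturbation `u • P` for `u ∈ [0, 1]`: `‖u • P θ‖ ≤ ‖P θ‖`. [folklore] -/
theorem norm_smul_le_of_mem_Icc {u : ℝ} (hu : u ∈ Icc (0 : ℝ) 1) (x : (ℝ × ℝ) × ℝ) :
    ‖u • x‖ ≤ ‖x‖ := by
  rw [norm_smul, Real.norm_of_nonneg hu.1]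
  exact mul_le_of_le_one_left (norm_nonneg _) hu.2

/-- The size of the derivative of `u • P` for `u ∈ [0, 1]`: `‖(u • P)' θ‖ ≤ ‖P' θ‖`. [folklore] -/
theorem norm_deriv_smul_le_of_mem_Icc (hP : ContDiff ℝ ∞ P) {u : ℝ} (hu : u ∈ Icc (0 : ℝ) 1)
    (θ : ℝ) : ‖deriv (fun θ ↦ u • P θ) θ‖ ≤ ‖deriv P θ‖ := by
  have e : (fun θ ↦ u • P θ) = u • P := rfl
  rw [e, deriv_const_smul _ (hP.differentiable (by simp) θ)]
  exact norm_smul_le_of_mem_Icc hu _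

/-- **All stages `u ∈ [0, 1]` are regular simple closed chart curves** when `P` obeys the
stability bound of `K.stereoCurve` (`exists_stability`). [folklore] -/
theorem exists_forall_pertFamily_regular (hK : ∀ x, K x ≠ northPole) :
    ∃ ε > 0, ∀ P : ℝ → (ℝ × ℝ) × ℝ, ContDiff ℝ ∞ P → Periodic P (2 * Real.pi) →
      (∀ θ, ‖P θ‖ ≤ ε) → (∀ θ, ‖deriv P θ‖ ≤ ε) →
      ∀ u ∈ Icc (0 : ℝ) 1, (∀ θ, deriv (pertFamily K P u) θ ≠ 0) ∧
        ∀ s₁ s₂, pertFamily K P u s₁ = pertFamily K P u s₂ → circlePoint s₁ = circlePoint s₂ := by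
  have hc1 : ContDiff ℝ 1 K.stereoCurve :=
    (contDiff_stereoCurve hK).of_le (by exact_mod_cast le_top)
  have hinj : ∀ s₁ s₂, K.stereoCurve s₁ = K.stereoCurve s₂ →
      ∃ k : ℤ, s₁ = s₂ + k * (2 * Real.pi) :=
    fun s₁ s₂ h ↦ exists_eq_add_of_circlePoint_eq ((stereoCurve_eq_iff hK).1 h)
  obtain ⟨ε, hε, hstab⟩ := exists_stability hc1 K.periodic_stereoCurve
    (deriv_stereoCurve_ne_zero hK) hinj
  refine ⟨ε, hε, fun P hP hPper hP0 hP1 u hu ↦ ?_⟩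
  have hQd : Differentiable ℝ fun θ ↦ u • P θ :=
    (hP.const_smul u).differentiable (by simp)
  have hQper : Periodic (fun θ ↦ u • P θ) (2 * Real.pi) := fun θ ↦ by
    simp only [hPper θ]
  obtain ⟨hreg, hinj'⟩ := hstab _ hQd hQper
    (fun θ ↦ (norm_smul_le_of_mem_Icc hu (P θ)).trans (hP0 θ))
    (fun θ ↦ (norm_deriv_smul_le_of_mem_Icc hP hu θ).trans (hP1 θ))
  refine ⟨hreg, fun s₁ s₂ h ↦ ?_⟩
  obtain ⟨k, hk⟩ := hinj' s₁ s₂ h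
  rw [hk]
  exact (periodic_circlePoint.int_mul k) s₂

/-! ### The family on the sphere (`CurveFamilyIsotopy.lean`) -/

/-- The straight-line family as a **family of closed curves on `𝕊³ ⊆ ℝ⁴`** (through the inverse
stereographic map). [folklore] -/
def pertCurveFamily (K : Knot) (P : ℝ → (ℝ × ℝ) × ℝ) (u : ℝ) : ℝ → 𝔼 4 :=
  stereoNorthInvCoe ∘ pertFamily K P u

/-- The family on the sphere is jointly `C^∞`. [folklore] -/
theorem contDiff_uncurry_pertCurveFamily (hK : ∀ x, K x ≠ northPole) (hP : ContDiff ℝ ∞ P) :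
    ContDiff ℝ ∞ (uncurry (pertCurveFamily K P)) := by
  -- (elaborating `ContDiff.comp` against its β-reduced form is pathologically slow here)
  have h := contDiff_stereoNorthInvCoe.comp (contDiff_uncurry_pertFamily hK hP)
  simp only [Function.comp_def] at h
  exact h

/-- The stages `u` at which the chart curve is regular are regular closed curves on the sphere.
[folklore] -/
theorem isRegularClosedCurve_pertCurveFamily (hK : ∀ x, K x ≠ northPole) (hP : ContDiff ℝ ∞ P)
    (hPper : Periodic P (2 * Real.pi)) {u : ℝ} (hreg : ∀ θ, deriv (pertFamily K P u) θ ≠ 0) :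
    IsRegularClosedCurve (pertCurveFamily K P u) :=
  isRegularClosedCurve_stereoNorthInvCoe_comp (contDiff_pertFamily hK hP u)
    (periodic_pertFamily hPper u) hreg

/-- At `u = 0` the family on the sphere is the curve of `K`. [folklore] -/
theorem pertCurveFamily_zero (hK : ∀ x, K x ≠ northPole) :
    pertCurveFamily K P 0 = SphereEmbedding.curve K := by
  rw [pertCurveFamily, pertFamily_zero, curve_eq_stereoNorthInvCoe_comp hK]

/-- At `u = 1` the family on the sphere is the curve of the perturbed chart curve. [folklore] -/
theorem pertCurveFamily_one :
    pertCurveFamily K P 1 = stereoNorthInvCoe ∘ fun θ ↦ K.stereoCurve θ + P θ := by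
  rw [pertCurveFamily, pertFamily_one]

/-- **A knot is the knot of its own curve** (`IsRegularClosedCurve.toKnot` of
`SphereEmbedding.curve K`, for any admissible proofs). [folklore] -/
theorem _root_.Literature.Topology.FourManifolds.SphereEmbedding.toKnot_curve (K : Knot)
    (h : IsRegularClosedCurve (SphereEmbedding.curve K))
    (hinj : ∀ s t, SphereEmbedding.curve K s = SphereEmbedding.curve K t →
      circlePoint s = circlePoint t) :
    h.toKnot hinj = K := by
  apply SphereEmbedding.ext
  funext u
  obtain ⟨θ, rfl⟩ := circlePoint_surjective u
  apply Subtype.ext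
  exact h.coe_toKnot_circlePoint hinj θ

omit P in
/-- The curve of a knot identifies only parameters with the same point on the circle. [folklore] -/
theorem circlePoint_eq_of_curve_eq (K : Knot) (s t : ℝ)
    (h : SphereEmbedding.curve K s = SphereEmbedding.curve K t) : circlePoint s = circlePoint t :=
  K.injective (Subtype.ext h)

/-- **The perturbed knot**: the knot of the chart curve `stereoCurve K + P` (when that curve is
regular and injective modulo `2π`). [folklore] -/
def pertKnot (hK : ∀ x, K x ≠ northPole) (hP : ContDiff ℝ ∞ P) (hPper : Periodic P (2 * Real.pi))
    (hreg : ∀ θ, deriv (fun θ ↦ K.stereoCurve θ + P θ) θ ≠ 0)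
    (hinj : ∀ s t, K.stereoCurve s + P s = K.stereoCurve t + P t → circlePoint s = circlePoint t) :
    Knot :=
  knotOfStereoCurve (e := fun θ ↦ K.stereoCurve θ + P θ) ((contDiff_stereoCurve hK).add hP)
    (fun θ ↦ by simp only [K.periodic_stereoCurve θ, hPper θ]) hreg hinj

/-- The chart curve of the perturbed knot is `stereoCurve K + P`. [folklore] -/
theorem stereoCurve_pertKnot (hK : ∀ x, K x ≠ northPole) (hP : ContDiff ℝ ∞ P)
    (hPper : Periodic P (2 * Real.pi)) (hreg : ∀ θ, deriv (fun θ ↦ K.stereoCurve θ + P θ) θ ≠ 0)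
    (hinj : ∀ s t, K.stereoCurve s + P s = K.stereoCurve t + P t → circlePoint s = circlePoint t) :
    (pertKnot hK hP hPper hreg hinj).stereoCurve = fun θ ↦ K.stereoCurve θ + P θ :=
  stereoCurve_knotOfStereoCurve _ _ _ _

/-- The perturbed knot misses the north pole. [folklore] -/
theorem pertKnot_ne_northPole (hK : ∀ x, K x ≠ northPole) (hP : ContDiff ℝ ∞ P)
    (hPper : Periodic P (2 * Real.pi)) (hreg : ∀ θ, deriv (fun θ ↦ K.stereoCurve θ + P θ) θ ≠ 0)
    (hinj : ∀ s t, K.stereoCurve s + P s = K.stereoCurve t + P t → circlePoint s = circlePoint t)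
    (x : 𝕊 1) : pertKnot hK hP hPper hreg hinj x ≠ northPole :=
  knotOfStereoCurve_ne_northPole _ _ _ _ x

/-- **Small perturbations of a knot in the chart are isotopic to it.** Let `K` miss the north
pole. There is `ε > 0` such that for every `C^∞`, `2π`-periodic `P : ℝ → (ℝ × ℝ) × ℝ` with
`‖P θ‖ ≤ ε` and `‖P' θ‖ ≤ ε` for all `θ`, some knot `K'` ambient isotopic to `K` misses the north
pole and has chart curve `stereoCurve K' = stereoCurve K + P` (the straight-line family of regular
simple closed curves `pertCurveFamily`, `IsRegularClosedCurve.isIsotopic_of_family_Icc` of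
`CurveFamilyIsotopy.lean`, i.e. the isotopy extension theorem). Hirsch (1976), Ch. 8 §1,
Thm. 1.3; Crowell–Fox, Ch. I §2. [cite: HirschDT1976, Ch. 8 §1, Thm. 1.3] -/
theorem exists_isIsotopic_stereoCurve_add (hK : ∀ x, K x ≠ northPole) :
    ∃ ε > 0, ∀ P : ℝ → (ℝ × ℝ) × ℝ, ContDiff ℝ ∞ P → Periodic P (2 * Real.pi) →
      (∀ θ, ‖P θ‖ ≤ ε) → (∀ θ, ‖deriv P θ‖ ≤ ε) →
      ∃ K' : Knot, K.IsIsotopic K' ∧ (∀ x, K' x ≠ northPole) ∧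
        K'.stereoCurve = fun θ ↦ K.stereoCurve θ + P θ := by
  obtain ⟨ε, hε, hall⟩ := exists_forall_pertFamily_regular hK
  refine ⟨ε, hε, fun P hP hPper hP0 hP1 ↦ ?_⟩
  have hallP := hall P hP hPper hP0 hP1
  -- the family of regular simple closed curves on the sphere, `u ∈ [0, 1]`
  have hcurve : ∀ u ∈ Icc (0 : ℝ) 1, IsRegularClosedCurve (pertCurveFamily K P u) := fun u hu ↦
    isRegularClosedCurve_pertCurveFamily hK hP hPper (hallP u hu).1
  have hinj : ∀ u ∈ Icc (0 : ℝ) 1, ∀ s t, pertCurveFamily K P u s = pertCurveFamily K P u t →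
      circlePoint s = circlePoint t := fun u hu ↦
    stereoNorthInvCoe_comp_eq_imp (e := pertFamily K P u) (hallP u hu).2
  have hiso := IsRegularClosedCurve.isIsotopic_of_family_Icc
    (contDiff_uncurry_pertCurveFamily hK hP) hcurve hinj
  -- the end stage
  have hreg1 : ∀ θ, deriv (fun θ ↦ K.stereoCurve θ + P θ) θ ≠ 0 := by
    have := (hallP 1 ⟨zero_le_one, le_rfl⟩).1
    rwa [pertFamily_one] at this
  have hinj1 : ∀ s t, K.stereoCurve s + P s = K.stereoCurve t + P t →
      circlePoint s = circlePoint t := by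
    have := (hallP 1 ⟨zero_le_one, le_rfl⟩).2
    rwa [pertFamily_one] at this
  refine ⟨pertKnot hK hP hPper hreg1 hinj1, ?_, pertKnot_ne_northPole hK hP hPper hreg1 hinj1,
    stereoCurve_pertKnot hK hP hPper hreg1 hinj1⟩
  -- identify the endpoints of the family isotopy
  rw [IsRegularClosedCurve.toKnot_congr (hcurve 0 ⟨le_rfl, zero_le_one⟩)
      (SphereEmbedding.isRegularClosedCurve_curve K) (hinj 0 ⟨le_rfl, zero_le_one⟩)
      (circlePoint_eq_of_curve_eq K) (pertCurveFamily_zero hK),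
    SphereEmbedding.toKnot_curve,
    IsRegularClosedCurve.toKnot_congr (hcurve 1 ⟨zero_le_one, le_rfl⟩)
      (isRegularClosedCurve_stereoNorthInvCoe_comp ((contDiff_stereoCurve hK).add hP)
        (fun θ ↦ by simp only [K.periodic_stereoCurve θ, hPper θ]) hreg1)
      (hinj 1 ⟨zero_le_one, le_rfl⟩) (stereoNorthInvCoe_comp_eq_imp hinj1)
      pertCurveFamily_one] at hiso
  exact hiso

end Knot

end Literature.Topology.FourManifolds
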